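import Mathlib.Analysis.Distribution.AEEqOfIntegralContDiff
import Mathlib.MeasureTheory.Function.ContinuousMapDense
import Mathlib.MeasureTheory.Group.Integral
import Mathlib.Analysis.Normed.Operator.BoundedLinearMaps
import HarnessLib.Audit
import HarnessLib

/-!
# L3TimeExponentPincer — weak limits of fields equivariant under isometries converging to a translation

Support kernel (pure measure theory, Mathlib-only) for the crux `L3CascadeJaw`
(item stmt-NavierStokesRegularity-19499) of route `L3TimeExponentPincer`: the abstract half of the
**receding-axis lemma** (planner nsreg-p2, ROUND-12 §2b (J)-step and §Seeds (s2): «weak limits of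
fields invariant under rotations about receding axes are translation-invariant ⇒ 0 in `L^p`,
`p < ∞`», the input of the compactness reduction `CritSmoothingNoSwirlB ⇐ (SFL³)`), completed in
`…Theorems.L3TimeExponentPincerRecedingAxis`.  Three lemmas on a finite-dimensional real normed
space `E` with an additive Haar measure `μ`, values in a complete normed space `F`:

* `ae_eq_zero_of_memLp_of_comp_add_ae_eq` — **an `L^p` function invariant under one non-zero
  translation vanishes**: `1 ≤ p < ∞`, `f ∈ L^p(μ)`, `c ≠ 0`, `f (· + c) = f` a.e. `⟹ f = 0` a.e.
  (Proof: `f (· + n c) = f` a.e. for all `n : ℕ`; approximate `f` in `L^p` by a continuous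
  compactly supported `g` within `ε/3`; for `n‖c‖` larger than the diameter of the support,
  `‖g‖ ≤ ‖g (· + n c) - g‖` pointwise, and the right side is within `2ε/3` of
  `f (· + n c) - f = 0`; so `‖f‖_p ≤ ε`.)
* `integral_smul_eq_integral_smul_comp_sub_of_tendsto` /
  `ae_comp_add_eq_self_of_tendsto_integral_smul` — **invariance passes to distributional
  limits**: if `f_k → fl` against all test functions `g ∈ C_c^∞(E; ℝ)` (`∫ g • f_k → ∫ g • fl`),
  the `f_k` are locally integrable with locally uniform `L¹` bounds, and each `f_k` is
  equivariant, `f_k (T_k x) = M_k (f_k x)` a.e., under a measure-preserving isometry `T_k` of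
  `E` and a continuous linear `M_k : F → F`, where `T_k → (· + c)` uniformly on bounded sets and
  `M_k → 1` in operator norm, then `fl (· + c) = fl` a.e.  (Proof: change variables in
  `∫ g • f_k`, compare `g ∘ T_k` with `g (· + c)` uniformly — `g` is uniformly continuous and
  all supports lie in one ball because the `T_k` are isometries — and identify the two limits;
  conclude with Mathlib's `ae_eq_of_integral_contDiff_smul_eq`.)
* `exists_setIntegral_norm_le_of_eLpNorm_le` — a uniform `L^p` bound gives the locally uniform
  `L¹` bounds used above (Hölder on balls).

Source of the device: Koch–Nadirashvili–Seregin–Šverák, *Liouville theorems for the Navier–Stokes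
equations and applications*, Acta Math. 203 (2009), proof of Thm. 6.2 (arXiv:0709.3599 p. 13:
«since the solutions `v^(k)` are axi-symmetric and `M_k ↗ ∞`, it is easy to see that `w` is
independent of the `x₂`-variable»), here in the weak-convergence setting.  Standard real analysis.
WHAT THIS IS NOT: not NS regularity or blow-up; nothing here mentions the Navier–Stokes equations;
the crux `L3CascadeJaw` is untouched; no crux claim.
-/

noncomputable section

open MeasureTheory Set Function Filter Topology Metric
open scoped ENNReal NNReal ContDiff

namespace Summit.NavierStokesRegularity.NavierStokesRegularity.Theorems.L3TimeExponentPincerTranslationInvariantLimit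

variable {E : Type*} [NormedAddCommGroup E] [NormedSpace ℝ E] [FiniteDimensional ℝ E]
  [MeasurableSpace E] [BorelSpace E] {μ : Measure E} [μ.IsAddHaarMeasure]
  {F : Type*} [NormedAddCommGroup F] [NormedSpace ℝ F] [CompleteSpace F]

/-! ### An `L^p` function invariant under a non-zero translation is zero -/

omit [FiniteDimensional ℝ E] [NormedAddCommGroup F] [NormedSpace ℝ F] [CompleteSpace F] in
/-- Iterating an a.e. translation invariance: `f (· + c) = f` a.e. gives `f (· + n c) = f` a.e. for
every `n : ℕ` (translations preserve `μ`, so a.e. identities can be composed with them). -/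
theorem comp_add_natCast_smul_ae_eq {f : E → F} {c : E}
    (hinv : (fun x => f (x + c)) =ᵐ[μ] f) (n : ℕ) :
    (fun x => f (x + (n : ℝ) • c)) =ᵐ[μ] f := by
  induction n with
  | zero => simp
  | succ n ih =>
    have h1 : (fun x => f ((x + c) + (n : ℝ) • c)) =ᵐ[μ] fun x => f (x + c) :=
      (measurePreserving_add_right μ c).quasiMeasurePreserving.ae_eq ih
    have h2 : (fun x => f (x + ((n + 1 : ℕ) : ℝ) • c)) = fun x => f ((x + c) + (n : ℝ) • c) := by
      funext x
      congr 1
      rw [Nat.cast_succ, add_smul, one_smul]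
      abel
    rw [h2]
    exact h1.trans hinv

omit [CompleteSpace F] in
/-- **An `L^p` function (`1 ≤ p < ∞`) which is a.e. invariant under one non-zero translation
vanishes a.e.**  Proof by approximation with continuous compactly supported functions: if
`‖f - g‖_p ≤ ε/3` and `n‖c‖` exceeds the diameter of `tsupport g`, then pointwise
`‖g‖ ≤ ‖g(· + nc) - g‖`, while `g(· + nc) - g` is within `2ε/3` of `f(· + nc) - f = 0` in `L^p`;
hence `‖f‖_p ≤ ε` for every `ε > 0`. -/
theorem ae_eq_zero_of_memLp_of_comp_add_ae_eq {p : ℝ≥0∞} (hp1 : 1 ≤ p) (hp : p ≠ ⊤)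
    {f : E → F} (hf : MemLp f p μ) {c : E} (hc : c ≠ 0)
    (hinv : (fun x => f (x + c)) =ᵐ[μ] f) : f =ᵐ[μ] 0 := by
  have hp0 : p ≠ 0 := (lt_of_lt_of_le zero_lt_one hp1).ne'
  suffices h0 : eLpNorm f p μ = 0 from (eLpNorm_eq_zero_iff hf.1 hp0).1 h0
  refine nonpos_iff_eq_zero.1 (ENNReal.le_of_forall_pos_le_add fun ε hε _ => ?_)
  rw [zero_add]
  have hε3 : ((ε : ℝ≥0∞) / 3) ≠ 0 :=
    (ENNReal.div_pos (by exact_mod_cast hε.ne') (by norm_num)).ne'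
  obtain ⟨g, hgs, hfg, hgc, hgp⟩ := hf.exists_hasCompactSupport_eLpNorm_sub_le hp hε3
  obtain ⟨R, hR⟩ : ∃ R, tsupport g ⊆ closedBall (0 : E) R :=
    hgs.isCompact.isBounded.subset_closedBall 0
  obtain ⟨n, hn⟩ : ∃ n : ℕ, 2 * R + 1 ≤ (n : ℝ) * ‖c‖ := by
    obtain ⟨n, hn⟩ := exists_nat_ge ((2 * R + 1) / ‖c‖)
    exact ⟨n, (div_le_iff₀ (norm_pos_iff.2 hc)).1 hn⟩
  -- the translated functions
  set G : E → F := fun x => g (x + (n : ℝ) • c) with hG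
  set Fτ : E → F := fun x => f (x + (n : ℝ) • c) with hFτ
  have hτ : MeasurePreserving (fun x : E => x + (n : ℝ) • c) μ μ := measurePreserving_add_right μ _
  -- pointwise: `‖g x‖ ≤ ‖G x - g x‖`
  have hpt : ∀ x, ‖g x‖ ≤ ‖(G - g) x‖ := by
    intro x
    simp only [Pi.sub_apply, hG]
    by_cases hx : x ∈ tsupport g
    · have hx' : x + (n : ℝ) • c ∉ tsupport g := by
        intro h'
        have h1 : ‖x‖ ≤ R := mem_closedBall_zero_iff.1 (hR hx)
        have h2 : ‖x + (n : ℝ) • c‖ ≤ R := mem_closedBall_zero_iff.1 (hR h')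
        have h3 : ‖(n : ℝ) • c‖ = (n : ℝ) * ‖c‖ := by
          rw [norm_smul, Real.norm_of_nonneg (Nat.cast_nonneg n)]
        have h4 : ‖(n : ℝ) • c‖ ≤ ‖x + (n : ℝ) • c‖ + ‖x‖ := by
          calc ‖(n : ℝ) • c‖ = ‖(x + (n : ℝ) • c) - x‖ := by rw [add_sub_cancel_left]
            _ ≤ ‖x + (n : ℝ) • c‖ + ‖x‖ := norm_sub_le _ _
        linarith
      rw [image_eq_zero_of_notMem_tsupport hx', zero_sub, norm_neg]
    · rw [image_eq_zero_of_notMem_tsupport hx, norm_zero]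
      exact norm_nonneg _
  have hmono : eLpNorm g p μ ≤ eLpNorm (G - g) p μ := eLpNorm_mono hpt
  -- measurability
  have hGm : AEStronglyMeasurable G μ :=
    (hgc.comp (continuous_id.add continuous_const)).aestronglyMeasurable
  have hFτm : AEStronglyMeasurable Fτ μ := hf.1.comp_quasiMeasurePreserving hτ.quasiMeasurePreserving
  -- the three pieces
  have e1 : eLpNorm (G - Fτ) p μ = eLpNorm (f - g) p μ := by
    have h := eLpNorm_comp_measurePreserving (p := p) (hgp.1.sub hf.1) hτ
    rw [eLpNorm_sub_comm f g, ← h]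
    rfl
  have e2 : eLpNorm (Fτ - f) p μ = 0 := by
    have hae : (Fτ - f) =ᵐ[μ] (0 : E → F) := by
      filter_upwards [comp_add_natCast_smul_ae_eq hinv n] with x hx
      simp [hFτ, hx]
    rw [eLpNorm_congr_ae hae, eLpNorm_zero]
  have key : G - g = (G - Fτ) + ((Fτ - f) + (f - g)) := by abel
  have hGg : eLpNorm (G - g) p μ ≤ (ε : ℝ≥0∞) / 3 + (ε : ℝ≥0∞) / 3 := by
    calc eLpNorm (G - g) p μ
        ≤ eLpNorm (G - Fτ) p μ + eLpNorm ((Fτ - f) + (f - g)) p μ := by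
          rw [key]; exact eLpNorm_add_le (hGm.sub hFτm) ((hFτm.sub hf.1).add (hf.1.sub hgp.1)) hp1
      _ ≤ eLpNorm (G - Fτ) p μ + (eLpNorm (Fτ - f) p μ + eLpNorm (f - g) p μ) := by
          gcongr; exact eLpNorm_add_le (hFτm.sub hf.1) (hf.1.sub hgp.1) hp1
      _ = eLpNorm (f - g) p μ + (0 + eLpNorm (f - g) p μ) := by rw [e1, e2]
      _ ≤ (ε : ℝ≥0∞) / 3 + (0 + (ε : ℝ≥0∞) / 3) := by gcongr
      _ = _ := by rw [zero_add]
  calc eLpNorm f p μ = eLpNorm ((f - g) + g) p μ := by rw [sub_add_cancel]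
    _ ≤ eLpNorm (f - g) p μ + eLpNorm g p μ := eLpNorm_add_le (hf.1.sub hgp.1) hgp.1 hp1
    _ ≤ (ε : ℝ≥0∞) / 3 + ((ε : ℝ≥0∞) / 3 + (ε : ℝ≥0∞) / 3) := by
        gcongr; exact hmono.trans hGg
    _ = ε := by rw [← add_assoc, ENNReal.add_thirds]

/-! ### Locally uniform `L¹` bounds from a uniform `L^p` bound -/

omit [BorelSpace E] [NormedSpace ℝ F] [CompleteSpace F] in
/-- Hölder on a ball: a uniform `L^p` bound (`1 ≤ p`, bound `B < ∞`) on a family gives, for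
every radius, a uniform bound on the `L¹` norms over the closed ball. -/
theorem exists_setIntegral_norm_le_of_eLpNorm_le {ι : Type*} {p : ℝ≥0∞} (hp1 : 1 ≤ p)
    {f : ι → E → F} (hf : ∀ k, AEStronglyMeasurable (f k) μ) {B : ℝ≥0∞} (hB : B ≠ ⊤)
    (hfB : ∀ k, eLpNorm (f k) p μ ≤ B) (R : ℝ) :
    ∃ C : ℝ, ∀ k, ∫ x in closedBall (0 : E) R, ‖f k x‖ ∂μ ≤ C := by
  set ν : Measure E := μ.restrict (closedBall (0 : E) R) with hν
  haveI : IsFiniteMeasure ν := by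
    rw [hν]
    exact isFiniteMeasure_restrict.2 (isCompact_closedBall (0 : E) R).measure_lt_top.ne
  set K : ℝ≥0∞ := B * ν univ ^ (1 / (1 : ℝ≥0∞).toReal - 1 / p.toReal) with hK
  have hKtop : K ≠ ⊤ := by
    refine ENNReal.mul_ne_top hB (ENNReal.rpow_ne_top_of_nonneg ?_ (measure_ne_top ν _))
    rw [ENNReal.toReal_one, div_one, sub_nonneg]
    rcases eq_or_ne p ⊤ with h | h
    · simp [h]
    · rw [div_le_one (ENNReal.toReal_pos (lt_of_lt_of_le zero_lt_one hp1).ne' h)]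
      have : (1 : ℝ≥0∞).toReal ≤ p.toReal := ENNReal.toReal_mono h hp1
      simpa using this
  refine ⟨K.toReal, fun k => ?_⟩
  have hmem : MemLp (f k) p ν := by
    refine ⟨(hf k).restrict, ?_⟩
    exact lt_of_le_of_lt ((eLpNorm_mono_measure (f k) Measure.restrict_le_self).trans (hfB k))
      hB.lt_top
  have hint : Integrable (f k) ν := hmem.integrable hp1
  have h1 : eLpNorm (f k) 1 ν ≤ K :=
    (eLpNorm_le_eLpNorm_mul_rpow_measure_univ hp1 (hf k).restrict).trans
      (mul_le_mul_left ((eLpNorm_mono_measure (f k) Measure.restrict_le_self).trans (hfB k)) _)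
  rw [integral_norm_eq_lintegral_enorm hint.1, ← eLpNorm_one_eq_lintegral_enorm]
  exact ENNReal.toReal_mono hKtop h1

/-! ### Invariance passes to distributional limits -/

/-- **Distributional limits of equivariant fields.**  Let `T_k` be measure-preserving isometries
of `E` converging to the translation `· + c` uniformly on bounded sets, `M_k : F →L[ℝ] F` with
`M_k → 1`, and `f_k` locally integrable, with locally uniform `L¹` bounds, `T_k`-equivariant
(`f_k ∘ T_k = M_k ∘ f_k` a.e.) and converging to the locally integrable `fl` against every test
function `g ∈ C_c^∞(E; ℝ)`.  Then for every such `g`,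
`∫ g • fl = ∫ g x • fl (x - c)`. -/
theorem integral_smul_eq_integral_smul_comp_sub_of_tendsto
    {f : ℕ → E → F} {fl : E → F} {T : ℕ → E → E} {M : ℕ → (F →L[ℝ] F)} {c : E}
    (hTμ : ∀ k, MeasurePreserving (T k) μ μ) (hTi : ∀ k, Isometry (T k))
    (hTc : ∀ R ε : ℝ, 0 < ε → ∀ᶠ k in atTop, ∀ z ∈ closedBall (0 : E) R, ‖T k z - (z + c)‖ ≤ ε)
    (hM : Tendsto M atTop (𝓝 1))
    (heq : ∀ k, (fun x => f k (T k x)) =ᵐ[μ] fun x => M k (f k x))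
    (hf : ∀ k, LocallyIntegrable (f k) μ)
    (hbd : ∀ R : ℝ, ∃ C : ℝ, ∀ k, ∫ x in closedBall (0 : E) R, ‖f k x‖ ∂μ ≤ C)
    (hconv : ∀ g : E → ℝ, ContDiff ℝ ∞ g → HasCompactSupport g →
      Tendsto (fun k => ∫ x, g x • f k x ∂μ) atTop (𝓝 (∫ x, g x • fl x ∂μ)))
    {g : E → ℝ} (hg : ContDiff ℝ ∞ g) (hgs : HasCompactSupport g) :
    ∫ x, g x • fl x ∂μ = ∫ x, g x • fl (x - c) ∂μ := by
  haveI : CompleteSpace E := FiniteDimensional.complete ℝ E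
  -- the shifted test function
  have hgc : Continuous g := hg.continuous
  have hg' : ContDiff ℝ ∞ (fun z => g (z + c)) := hg.comp (contDiff_id.add contDiff_const)
  have hgs' : HasCompactSupport (fun z => g (z + c)) := hgs.comp_homeomorph (Homeomorph.addRight c)
  have hgc' : Continuous (fun z => g (z + c)) := hg'.continuous
  -- notation
  set I : ℕ → F := fun k => ∫ z, g (T k z) • f k z ∂μ with hI_def
  set J : ℕ → F := fun k => ∫ z, g (z + c) • f k z ∂μ with hJ_def
  set Jlim : F := ∫ z, g (z + c) • fl z ∂μ with hJlim
  have hgT : ∀ k, Continuous (fun z => g (T k z)) := fun k => hgc.comp (hTi k).continuous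
  have hgTs : ∀ k, HasCompactSupport (fun z => g (T k z)) := fun k =>
    hgs.comp_isClosedEmbedding (hTi k).isClosedEmbedding
  have hintI : ∀ k, Integrable (fun z => g (T k z) • f k z) μ := fun k =>
    (hf k).integrable_smul_left_of_hasCompactSupport (hgT k) (hgTs k)
  have hintJ : ∀ k, Integrable (fun z => g (z + c) • f k z) μ := fun k =>
    (hf k).integrable_smul_left_of_hasCompactSupport hgc' hgs'
  -- (i) change of variables and equivariance: `∫ g • f_k = M_k (I k)`
  have hI : ∀ k, ∫ x, g x • f k x ∂μ = M k (I k) := by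
    intro k
    have hemb : MeasurableEmbedding (T k) := (hTi k).isClosedEmbedding.measurableEmbedding
    rw [← (hTμ k).integral_comp hemb (fun x => g x • f k x)]
    have hae : (fun z => g (T k z) • f k (T k z)) =ᵐ[μ] fun z => M k (g (T k z) • f k z) := by
      filter_upwards [heq k] with z hz
      rw [hz, map_smul]
    rw [integral_congr_ae hae, ContinuousLinearMap.integral_comp_comm _ (hintI k)]
  -- (ii) the shifted test function: `J k → Jlim`
  have hJ : Tendsto J atTop (𝓝 Jlim) := hconv _ hg' hgs'
  -- (iii) `I k - J k → 0`
  have hIJ : Tendsto (fun k => I k - J k) atTop (𝓝 0) := by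
    obtain ⟨Rg, hRg⟩ : ∃ R, tsupport g ⊆ closedBall (0 : E) R :=
      hgs.isCompact.isBounded.subset_closedBall 0
    set R' : ℝ := Rg + ‖c‖ + 1 with hR'
    obtain ⟨C, hC⟩ := hbd R'
    have hC0 : 0 ≤ C := le_trans (integral_nonneg fun _ => norm_nonneg _) (hC 0)
    rw [Metric.tendsto_atTop]
    intro ε hε
    have hgu : UniformContinuous g := hgs.uniformContinuous_of_continuous hgc
    obtain ⟨δ, hδ, hgδ⟩ := Metric.uniformContinuous_iff.1 hgu (ε / (C + 1)) (by positivity)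
    obtain ⟨N, hN⟩ := eventually_atTop.1 ((hTc R' (δ / 2) (by positivity)).and (hTc 0 1 one_pos))
    refine ⟨N, fun k hk => ?_⟩
    obtain ⟨hk1, hk2⟩ := hN k hk
    have hT0 : ‖T k 0 - c‖ ≤ 1 := by
      simpa using hk2 0 (mem_closedBall_self le_rfl)
    -- pointwise bound on the integrand of `I k - J k`
    have hpt : ∀ z, ‖(g (T k z) - g (z + c)) • f k z‖ ≤
        (closedBall (0 : E) R').indicator (fun z => ε / (C + 1) * ‖f k z‖) z := by
      intro z
      by_cases hz : z ∈ closedBall (0 : E) R'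
      · rw [indicator_of_mem hz, norm_smul]
        refine mul_le_mul_of_nonneg_right ?_ (norm_nonneg _)
        have hd : dist (T k z) (z + c) < δ := by
          rw [dist_eq_norm]; linarith [hk1 z hz]
        have := hgδ hd
        rw [Real.dist_eq] at this
        exact (Real.norm_eq_abs _).le.trans this.le
      · rw [indicator_of_notMem hz]
        have hz' : R' < ‖z‖ := by simpa [mem_closedBall_zero_iff] using hz
        have h1 : g (z + c) = 0 := by
          apply image_eq_zero_of_notMem_tsupport
          intro h
          have hzc := mem_closedBall_zero_iff.1 (hRg h)
          have : ‖z‖ ≤ ‖z + c‖ + ‖c‖ := by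
            calc ‖z‖ = ‖(z + c) - c‖ := by rw [add_sub_cancel_right]
              _ ≤ ‖z + c‖ + ‖c‖ := norm_sub_le _ _
          linarith
        have h2 : g (T k z) = 0 := by
          apply image_eq_zero_of_notMem_tsupport
          intro h
          have hTz := mem_closedBall_zero_iff.1 (hRg h)
          have hd : dist (T k z) (T k 0) = dist z 0 := (hTi k).dist_eq z 0
          have h3 : ‖z‖ ≤ ‖T k z‖ + ‖T k 0‖ := by
            rw [← dist_zero_right z, ← hd, dist_eq_norm]; exact norm_sub_le _ _
          have h4 : ‖T k 0‖ ≤ ‖c‖ + 1 := by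
            calc ‖T k 0‖ = ‖(T k 0 - c) + c‖ := by rw [sub_add_cancel]
              _ ≤ ‖T k 0 - c‖ + ‖c‖ := norm_add_le _ _
              _ ≤ ‖c‖ + 1 := by linarith
          linarith
        simp [h1, h2]
    have hint : Integrable ((closedBall (0 : E) R').indicator (fun z => ε / (C + 1) * ‖f k z‖)) μ := by
      rw [integrable_indicator_iff measurableSet_closedBall]
      exact (((hf k).integrableOn_isCompact (isCompact_closedBall (0 : E) R')).norm.const_mul _)
    have hdiff : I k - J k = ∫ z, (g (T k z) - g (z + c)) • f k z ∂μ := by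
      rw [hI_def, hJ_def, ← integral_sub (hintI k) (hintJ k)]
      congr 1
      funext z
      rw [sub_smul]
    rw [dist_zero_right, hdiff]
    calc ‖∫ z, (g (T k z) - g (z + c)) • f k z ∂μ‖
        ≤ ∫ z, (closedBall (0 : E) R').indicator (fun z => ε / (C + 1) * ‖f k z‖) z ∂μ :=
          norm_integral_le_of_norm_le hint (Eventually.of_forall hpt)
      _ = ε / (C + 1) * ∫ z in closedBall (0 : E) R', ‖f k z‖ ∂μ := by
          rw [integral_indicator measurableSet_closedBall, integral_const_mul]
      _ ≤ ε / (C + 1) * C := by gcongr; exact hC k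
      _ < ε := by
          rw [div_mul_eq_mul_div, div_lt_iff₀ (by positivity)]
          nlinarith
  -- (iv) hence `M k (I k) → Jlim`
  have hI' : Tendsto I atTop (𝓝 Jlim) := by
    have h := hIJ.add hJ
    simp only [sub_add_cancel, zero_add] at h
    exact h
  have hMI : Tendsto (fun k => M k (I k)) atTop (𝓝 Jlim) := by
    have hcont := (isBoundedBilinearMap_apply (𝕜 := ℝ) (E := F) (F := F)).continuous
    have h := (hcont.tendsto ((1 : F →L[ℝ] F), Jlim)).comp (hM.prodMk_nhds hI')
    exact h
  -- (v) identify the limits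
  have h1 : Tendsto (fun k => ∫ x, g x • f k x ∂μ) atTop (𝓝 Jlim) := by
    have : (fun k => ∫ x, g x • f k x ∂μ) = fun k => M k (I k) := funext hI
    rw [this]; exact hMI
  have h2 : ∫ x, g x • fl x ∂μ = Jlim := tendsto_nhds_unique (hconv g hg hgs) h1
  rw [h2, hJlim]
  have h3 : (fun z => g (z + c) • fl z) = fun z => (fun x => g x • fl (x - c)) (z + c) := by
    funext z
    simp only [add_sub_cancel_right]
  rw [h3]
  exact integral_add_right_eq_self (μ := μ) (fun x => g x • fl (x - c)) c

omit [NormedSpace ℝ E] [FiniteDimensional ℝ E] [NormedSpace ℝ F] [CompleteSpace F] in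
/-- Translates of locally integrable functions (Haar measure) are locally integrable. -/
theorem locallyIntegrable_comp_sub_right {f : E → F} (hf : LocallyIntegrable f μ) (c : E) :
    LocallyIntegrable (fun x => f (x - c)) μ := by
  have h := (locallyIntegrable_map_homeomorph (Homeomorph.subRight c) (f := f) (μ := μ)).1
  have hmap : Measure.map (⇑(Homeomorph.subRight c)) μ = μ := by
    rw [show (⇑(Homeomorph.subRight c) : E → E) = fun x => x - c from rfl, map_sub_right_eq_self]
  rw [hmap] at h
  exact h hf

/-- **Invariance passes to distributional limits.**  Under the hypotheses of
`integral_smul_eq_integral_smul_comp_sub_of_tendsto` (measure-preserving isometries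
`T_k → (· + c)` uniformly on bounded sets, `M_k → 1`, `f_k` locally integrable, locally
uniformly `L¹`-bounded, `f_k ∘ T_k = M_k ∘ f_k` a.e., `f_k → fl` against `C_c^∞` test functions,
`fl` locally integrable), the limit is invariant under the limit translation:
`fl (· + c) = fl` a.e. -/
theorem ae_comp_add_eq_self_of_tendsto_integral_smul
    {f : ℕ → E → F} {fl : E → F} {T : ℕ → E → E} {M : ℕ → (F →L[ℝ] F)} {c : E}
    (hTμ : ∀ k, MeasurePreserving (T k) μ μ) (hTi : ∀ k, Isometry (T k))
    (hTc : ∀ R ε : ℝ, 0 < ε → ∀ᶠ k in atTop, ∀ z ∈ closedBall (0 : E) R, ‖T k z - (z + c)‖ ≤ ε)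
    (hM : Tendsto M atTop (𝓝 1))
    (heq : ∀ k, (fun x => f k (T k x)) =ᵐ[μ] fun x => M k (f k x))
    (hf : ∀ k, LocallyIntegrable (f k) μ)
    (hbd : ∀ R : ℝ, ∃ C : ℝ, ∀ k, ∫ x in closedBall (0 : E) R, ‖f k x‖ ∂μ ≤ C)
    (hfl : LocallyIntegrable fl μ)
    (hconv : ∀ g : E → ℝ, ContDiff ℝ ∞ g → HasCompactSupport g →
      Tendsto (fun k => ∫ x, g x • f k x ∂μ) atTop (𝓝 (∫ x, g x • fl x ∂μ))) :
    (fun x => fl (x + c)) =ᵐ[μ] fl := by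
  have hae : ∀ᵐ x ∂μ, fl x = fl (x - c) :=
    ae_eq_of_integral_contDiff_smul_eq hfl (locallyIntegrable_comp_sub_right hfl c)
      (fun g hg hgs => integral_smul_eq_integral_smul_comp_sub_of_tendsto hTμ hTi hTc hM heq hf
        hbd hconv hg hgs)
  -- compose the a.e. identity `fl = fl (· - c)` with the translation `· + c`
  have h := (measurePreserving_add_right μ c).quasiMeasurePreserving.ae_eq hae
  filter_upwards [h] with x hx
  simpa using hx

end Summit.NavierStokesRegularity.NavierStokesRegularity.Theorems.L3TimeExponentPincerTranslationInvariantLimit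

end
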